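import Summits.CriticalPhenomena.PercolationContinuityZ3.Theorems.Transplant.SkelPhiCylBallFrom
import HarnessLib

/-!
# Quasi-step rung (N3-b), LEVEL 0, row κ1 of WAVE-Q-MANIFEST v0.1a: the cylinder hypothesis (κ″) 'cylinders of half-width `ℓ ≥ ℓ₀` are connected INSIDE THEIR
# `W`-FATTENING' (the shape of p3 g28's staged field `PlanarSkeletonFrmQuasi.cyl_reach` and of `OrbitQDatum.cyl_reach_of_le`, p497462) and the ONE (κ′)-consumer of
# the multi-type From node's used cone restated under it — exhaustion by fat prisms `fatSeq_exhaust_reach` — plus type reach and the (κ′) ⇒ (κ″) regression (`W = 0`)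

builds on p205010 (kernel theorem, internal audit signed; external expert review pending) — nothing in this file uses p205010; nothing here is a claim about any open node; no
carrier, no node, no definition (the hypothesis (κ″) is spelled inline, exactly as the staged field).  Lane `prim-bschramm`, seat `prim-bschramm-gen-1` (gen 4; GEN pen).
Helper file (`--supports stmt-CriticalPhenomena-4575 --as helper`).
WHY (HOME/WAVE-Q-MANIFEST.md §3 row κ1 / §4 item K1).  The census of the used cone of `frmFromProx_criticalContinuity_holds` (p486426) finds the cylinder field (κ′)
(`Skelφ.CylConnFrom`) READ by exactly one φ-level lemma below the carrier — `Skelφ.fatSeq_exhaust_from` («SkelPhiCylBallFrom» §2, feeding «SkelPhiStepIFrQFrom»'s seed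
scale) — besides the carrier's own connectivity.  Under quasi-steps the orbit construction no longer delivers cylinders connected AS INDUCED SUBGRAPHS (a reduction step near
the wall leaves the cylinder by one unit) but (κ″): any two vertices of `cyl t ℓ` are joined inside `cyl t (ℓ + W)`.  THIS FILE restates the consumer under (κ″): every
vertex lies in some fat prism `fatSeq hfr hC t n` about a base vertex (**`fatSeq_exhaust_reach`** — the walk now lives in the `W`-fattened cylinder, and the fat sequence is
monotone in the width, so `n := max (m + W) (length)` works), type reach (`exists_typeReach_reach`), and the regression (κ′) ⇒ (κ″) with `W = 0` (`cylReach_of_cylConnFrom`),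
under which `fatSeq_exhaust_reach` specialises to `fatSeq_exhaust_from`.
[cite: KozmaNitzan2024, §4 p. 19 (the wired cube), p. 20 ((22)–(23))] [cite: BenjaminiSchramm1996, Conj. 4]
-/

noncomputable section

namespace Summit.CriticalPhenomena.PercolationContinuityZ3.Theorems.Transplant

namespace Skelφ

open Literature.Probability.Percolation Literature.Probability.LatticeModels SimpleGraph
open Literature.Barriers.CriticalPhenomena (graphBall graphBall_finite mem_graphBall_self graphBall_mono)
open scoped Classical

variable {V : Type} {G : SimpleGraph V} {φ : V → Site 2}

/-! ## §1 (κ′) is (κ″) with no fattening -/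

/-- **Regression**: cylinders connected as induced subgraphs from width `ℓ₀` on ((κ′)) give (κ″) with `W = 0`. [folklore] -/
theorem cylReach_of_cylConnFrom {types : Finset V} {ℓ₀ : ℕ} (hκ : CylConnFrom G φ types ℓ₀) :
    ∀ t ∈ types, ∀ ℓ : ℕ, ℓ₀ ≤ ℓ → ∀ u v : V, u ∈ cyl φ t ℓ → v ∈ cyl φ t ℓ →
      ∃ (hu : u ∈ cyl φ t (ℓ + 0)) (hv : v ∈ cyl φ t (ℓ + 0)), (G.induce (cyl φ t (ℓ + 0))).Reachable ⟨u, hu⟩ ⟨v, hv⟩ := by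
  intro t ht ℓ hℓ u v hu hv
  simp only [add_zero]
  exact ⟨hu, hv, (hκ.connected ht hℓ).preconnected ⟨u, hu⟩ ⟨v, hv⟩⟩

/-! ## §2 Exhaustion by fat prisms under (κ″) -/

/-- **Exhaustion under (κ″)**: if any two vertices of each base cylinder of half-width `ℓ ≥ ℓ₀` are joined inside its `W`-fattening, every vertex lies in some fat prism
`fatSeq hfr hC t n` about the base vertex `t` (twin of `fatSeq_exhaust_from`; the internal width is raised by `ℓ₀ + W`). [folklore] -/
theorem fatSeq_exhaust_reach [G.LocallyFinite] [Countable V] {types : Finset V} {ℓ₀ W : ℕ}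
    (hκ : ∀ t ∈ types, ∀ ℓ : ℕ, ℓ₀ ≤ ℓ → ∀ u v : V, u ∈ cyl φ t ℓ → v ∈ cyl φ t ℓ →
      ∃ (hu : u ∈ cyl φ t (ℓ + W)) (hv : v ∈ cyl φ t (ℓ + W)), (G.induce (cyl φ t (ℓ + W))).Reachable ⟨u, hu⟩ ⟨v, hv⟩)
    (hfr : Frames G φ types) {p : unitInterval} (hC : CylSubcritical G φ types p) {t : V} (ht : t ∈ types) (v : V) :
    ∃ n, v ∈ fatSeq hfr hC t n := by
  -- a cylinder of half-width `m ≥ ℓ₀` containing `v`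
  set m : ℕ := (φ v 0 - φ t 0).natAbs + (φ v 1 - φ t 1).natAbs + ℓ₀ with hm
  have hvm : v ∈ cyl φ t m := by
    rw [mem_cyl, mem_box]
    intro i
    simp only [Pi.sub_apply]
    have ha0 := le_abs_self (φ v 0 - φ t 0); have ha0' := neg_abs_le (φ v 0 - φ t 0)
    have ha1 := le_abs_self (φ v 1 - φ t 1); have ha1' := neg_abs_le (φ v 1 - φ t 1)
    have hb0 := abs_nonneg (φ v 0 - φ t 0); have hb1 := abs_nonneg (φ v 1 - φ t 1)
    fin_cases i <;> constructor <;> simp only [hm] <;> push_cast <;> linarith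
  -- a walk in the fattened induced cylinder, by (κ″)
  obtain ⟨hu', hv', ⟨wk⟩⟩ := hκ t ht m (by omega) t v (self_mem_cyl φ t m) hvm
  refine ⟨max (m + W) wk.length, (mem_fatSeq_iff hfr hC).2 ?_⟩
  refine cylBall_mono G φ t (le_max_left _ _) ((le_max_right _ _).trans (le_fatRadius hfr hC _)) ?_
  exact ⟨⟨v, hv'⟩, ⟨wk, le_rfl⟩, rfl⟩

/-! ## §3 Type reach under (κ″) -/

/-- **Type reach** under (κ″): `k₀ ≥ max(1, ℓ₀ + W)` and `dI` with, for EVERY base vertex `t`, `φ t₀ − φ t ∈ Λ_{k₀}` and `t₀` within induced distance `dI` of `t` inside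
`cyl t k₀` (twin of `exists_typeReach_from`). [folklore] -/
theorem exists_typeReach_reach {types : Finset V} {ℓ₀ W : ℕ}
    (hκ : ∀ t ∈ types, ∀ ℓ : ℕ, ℓ₀ ≤ ℓ → ∀ u v : V, u ∈ cyl φ t ℓ → v ∈ cyl φ t ℓ →
      ∃ (hu : u ∈ cyl φ t (ℓ + W)) (hv : v ∈ cyl φ t (ℓ + W)), (G.induce (cyl φ t (ℓ + W))).Reachable ⟨u, hu⟩ ⟨v, hv⟩)
    (t₀ : V) : ∃ k₀ dI : ℕ, 1 ≤ k₀ ∧ ℓ₀ + W ≤ k₀ ∧ ∀ t ∈ types, φ t₀ - φ t ∈ box 2 k₀ ∧ t₀ ∈ cylBall G φ t k₀ dI := by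
  have hbox : ∀ t ∈ types, ∃ k : ℕ, φ t₀ - φ t ∈ box 2 k := fun t _ => exists_mem_box _
  choose! kt hkt using hbox
  set k₁ : ℕ := types.sup kt + ℓ₀ with hk₁
  set k₀ : ℕ := k₁ + W + 1 with hk₀
  have hk₁t : ∀ t ∈ types, φ t₀ - φ t ∈ box 2 k₁ := fun t ht =>
    box_mono 2 (by have := Finset.le_sup (f := kt) ht; omega) (hkt t ht)
  have hk₀t : ∀ t ∈ types, φ t₀ - φ t ∈ box 2 k₀ := fun t ht => box_mono 2 (by omega) (hk₁t t ht)
  have hwalk : ∀ t ∈ types, ∃ d : ℕ, t₀ ∈ cylBall G φ t k₀ d := by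
    intro t ht
    have hmem : t₀ ∈ cyl φ t k₁ := by rw [mem_cyl]; exact hk₁t t ht
    obtain ⟨hu', h₀, ⟨w⟩⟩ := hκ t ht k₁ (by omega) t t₀ (self_mem_cyl φ t k₁) hmem
    -- widen the induced walk from `k₁ + W` to `k₀`
    have hsub : cyl φ t (k₁ + W) ⊆ cyl φ t k₀ := cyl_mono φ t (by omega)
    exact ⟨w.length, cylBall_mono G φ t (show k₁ + W ≤ k₀ by omega) le_rfl ⟨⟨t₀, h₀⟩, ⟨w, le_rfl⟩, rfl⟩⟩
  choose! dt hdt using hwalk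
  refine ⟨k₀, types.sup dt, by omega, by omega, fun t ht => ⟨hk₀t t ht, ?_⟩⟩
  exact cylBall_mono G φ t le_rfl (Finset.le_sup (f := dt) ht) (hdt t ht)

end Skelφ

end Summit.CriticalPhenomena.PercolationContinuityZ3.Theorems.Transplant

end
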